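import Literature.NumberTheory.DiophantineGeometry.ApproximationBoundRatHalvesProofs
import Literature.NumberTheory.DiophantineGeometry.AbcStewartYu2001KummerPlaceBoundsProofs
import Literature.NumberTheory.DiophantineGeometry.AbcStewartYu2001PlaceBoundsProofs
import Literature.Barriers.ABC.BakerMethodBoundsHalfExponentProofs
import HarnessLib

/-!
# The Baker-method ladder over `ℚ` BY NAME: the library rung `approximationBound_rat` — and its
# `p`-adic half `padicApproximationBound_rat` ALONE — imply Stewart–Tijdeman 1986, Stewart–Yu 1991,
# Stewart–Yu 2001 Theorem 1 (`BakerMethodBounds` = `stewart_yu`) and Stewart–Yu 2001 Theorem 2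

Topic `Barriers/ABC`; namespace `Literature.Barriers.ABC`.  PROOFS ONLY (no `def`, no named fact, no
`sorry`): every theorem here is a composition of theorems already in the tree, re-keyed so that the
edges between the NAMED statements of the ladder are single Lean declarations.

The statements involved (all `def … : Prop` of the tree):

* the library rung `Literature.NumberTheory.DiophantineGeometry.Dioph.approximationBound_rat`
  (`∃ K ≥ 1, PastenApproximationBound K` — Pasten 2024, Theorem 2.1 at `d = 1`) and its two halves
  `Dioph.archApproximationBound_rat` (archimedean clause) and `Dioph.padicApproximationBound_rat`
  (`p`-adic clause), `ApproximationBoundRat.lean`;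
* `Literature.Barriers.ABC.stewartTijdeman1986_upperBound` (`log c < κ R^{15}`),
  `Literature.Barriers.ABC.stewartYu1991_upperBound` (the tree's `ε`-form of Stewart–Yu 1991:
  `∀ ε > 0 ∃ κ c₀, log c ≤ κ R^{2/3 + ε}` for `c ≥ c₀`, `= EpsShapeBound (2/3)` by
  `stewartYu1991_iff_epsShapeBound`; the printed `c`-independent `R^{2/3 + κ₁/log log R}` is not the
  typed statement),
  `Literature.Barriers.ABC.BakerMethodBounds` (`= BakerShapeBound (1/3) 3`, by name
  `Literature.NumberTheory.DiophantineGeometry.stewart_yu`, Stewart–Yu 2001 Theorem 1) and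
  `Literature.NumberTheory.DiophantineGeometry.stewartYu2001_thm2` (Stewart–Yu 2001 Theorem 2).

Results:

* `stewartTijdeman1986_of_padicApproximationBound_rat`, `stewartYu1991_of_padicApproximationBound_rat`,
  `BakerMethodBounds_of_padicApproximationBound_rat`, `stewart_yu_of_padicApproximationBound_rat`,
  `stewartYu2001_thm2_of_padicApproximationBound_rat` — **the `p`-adic half alone gives every rung**:
  for the exponents `15` and `1/2 ⊂ 2/3` no archimedean input is used at all
  (`stewartTijdeman1986_of_padicClause`, `stewartYu1991_of_padicClause`); for the exponent `1/3` and for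
  Theorem 2 the archimedean input is the tree's THEOREM
  `Literature.NumberTheory.Transcendental.Waldschmidt1980.waldschmidt1980_hW₂` (Waldschmidt 1980,
  Prop. 3.8 over `ℚ` under the `2`-Kummer condition, constant `w80Cw n = (2⁷⁰ n)ⁿ`), fed to
  `BakerMethodBounds_of_padicClause_kummerArchBound₂` and to
  `StewartYu2001.stewartYu2001_thm2_of_placeBounds₂` (whose two `p`-adic place bounds are
  `padic_bound_a₂` / `padic_bound_c₂` at threshold `N = 0`).
* `…_of_approximationBound_rat` — the same five edges from the full library rung (through
  `Dioph.padicApproximationBound_rat_of`, or directly through `BakerMethodBounds_of_approximationBound`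
  / `StewartYu2001.stewartYu2001_thm2_of_approximationBound`).
* `stewartYu2001_thm2_of_yu2007_rat` — Theorem 2 from the ONE primary fact
  `Literature.Barriers.ABC.yu2007_padicLogForm_rat` (Yu 2007 as Evertse–Győry Thm 3.2.7 over `ℚ`),
  through `Dioph.padicApproximationBound_rat_of_yu2007` (`ApproximationBoundRatHalvesProofs.lean`).
  (The summit cone has the same implication by the primes-only road,
  `Summit.ABC.StewartYu.ThmTwo.stewartYu2001_thm2_of_yu2007`; this is the Literature-side road through
  the general-`α` clause, importable from `Literature/`.)

No new mathematics; no claim about constants beyond those of the cited tree theorems.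

## References

* C. L. Stewart, R. Tijdeman, *On the Oesterlé–Masser conjecture*, Monatsh. Math. 102 (1986), Thm 1.
* C. L. Stewart, K. Yu, *On the abc conjecture*, Math. Ann. 291 (1991), Theorem.
* C. L. Stewart, K. Yu, *On the abc conjecture, II*, Duke Math. J. 108 (2001), Theorems 1 and 2.
* M. Waldschmidt, *A lower bound for linear forms in logarithms*, Acta Arith. 37 (1980), Prop. 3.8.
* H. Pasten, *The largest prime factor of `n² + 1` and improvements on subexponential `ABC`*,
  Invent. Math. 236 (2024), Theorem 2.1.
* J.-H. Evertse, K. Győry, *Unit Equations in Diophantine Number Theory*, CUP 2015, Thm 3.2.7, Thm 4.2.1.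
* K. Yu, *`p`-adic logarithmic forms and group varieties III*, Forum Math. 19 (2007), Main Theorem.
-/

noncomputable section

open Finset Real Height
open Literature.NumberTheory.DiophantineGeometry
open Literature.NumberTheory.DiophantineGeometry.Dioph
open Literature.NumberTheory.DiophantineGeometry.Pasten
open Literature.NumberTheory.DiophantineGeometry.StewartYu2001
open Literature.NumberTheory.Transcendental.Waldschmidt1980

namespace Literature.Barriers.ABC

/-! ### The `p`-adic half of the library rung alone -/

/-- **A1.L(p) ⇒ Stewart–Tijdeman 1986** (`log c < κ R^{15}`): the `p`-adic clause alone, any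
`K ≥ 1`, no archimedean input (`stewartTijdeman1986_of_padicClause`).
[cite: StewartTijdeman1986, Theorem 1 (upper bound), as quoted in Waldschmidt2014 §2 (PDF p. 3)]
[cite: Pasten2024, Theorem 2.1 (ii) (d = 1)] -/
theorem stewartTijdeman1986_of_padicApproximationBound_rat (h : padicApproximationBound_rat) :
    stewartTijdeman1986_upperBound := by
  obtain ⟨K, hK, hP⟩ := h
  exact stewartTijdeman1986_of_padicClause hK hP

/-- **A1.L(p) ⇒ Stewart–Yu 1991** (`ε`-form: `∀ ε > 0 ∃ κ c₀, log c ≤ κ R^{2/3 + ε}` for `c ≥ c₀`):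
the `p`-adic clause alone gives the exponent `1/2`, hence `2/3` (`stewartYu1991_of_padicClause`).
[cite: StewartYu1991, main theorem] [cite: Pasten2024, Theorem 2.1 (ii) (d = 1)] -/
theorem stewartYu1991_of_padicApproximationBound_rat (h : padicApproximationBound_rat) :
    stewartYu1991_upperBound := by
  obtain ⟨K, hK, hP⟩ := h
  exact stewartYu1991_of_padicClause hK hP

/-- **A1.L(p) ⇒ `BakerMethodBounds`** (Stewart–Yu 2001 Theorem 1, exponent `1/3`): the `p`-adic
clause with its constant `K ≥ 1` at the finite places, and at the archimedean place the tree's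
theorem `waldschmidt1980_hW₂` (Waldschmidt 1980, Prop. 3.8 over `ℚ`, `2`-Kummer condition,
`Cw = w80Cw`), through `BakerMethodBounds_of_padicClause_kummerArchBound₂`.  So the archimedean half
`archApproximationBound_rat` of the library rung is not needed for this rung.
[cite: StewartYu2001, Theorem 1] [cite: Waldschmidt1980, Prop 3.8 (p. 274)]
[cite: Pasten2024, Theorem 2.1 (ii) (d = 1)] -/
theorem BakerMethodBounds_of_padicApproximationBound_rat (h : padicApproximationBound_rat) :
    BakerMethodBounds := by
  obtain ⟨K, hK, hP⟩ := h
  exact BakerMethodBounds_of_padicClause_kummerArchBound₂ hK hP w80Cw w80Cw_nonneg waldschmidt1980_hW₂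

/-- **A1.L(p) ⇒ Stewart–Yu 2001 Theorem 1** (`abc.S06`,
`Literature.NumberTheory.DiophantineGeometry.stewart_yu`, which is `BakerMethodBounds` by name).
[cite: StewartYu2001, Theorem 1] [cite: Waldschmidt1980, Prop 3.8 (p. 274)] -/
theorem stewart_yu_of_padicApproximationBound_rat (h : padicApproximationBound_rat) :
    Literature.NumberTheory.DiophantineGeometry.stewart_yu :=
  BakerMethodBounds_iff_stewartYu.mp (BakerMethodBounds_of_padicApproximationBound_rat h)

/-- **A1.L(p) ⇒ Stewart–Yu 2001 Theorem 2** (`z < exp(p′ · G^{c log₃ G⋆ / log₂ G})`): the two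
`p`-adic place bounds of the grouped door `StewartYu2001.stewartYu2001_thm2_of_placeBounds₂` are the
instances `padic_bound_a₂` / `padic_bound_c₂` (threshold `N = 0`) of the `p`-adic clause; the door's
archimedean side is the tree's theorem `waldschmidt1980_hW₂`.
[cite: StewartYu2001, Theorem 2] [cite: Waldschmidt1980, Prop 3.8 (p. 274)]
[cite: Pasten2024, Theorem 2.1 (ii) (d = 1)] -/
theorem stewartYu2001_thm2_of_padicApproximationBound_rat (h : padicApproximationBound_rat) :
    stewartYu2001_thm2 := by
  obtain ⟨K, hK, hP⟩ := h
  exact stewartYu2001_thm2_of_placeBounds₂ hK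
    (fun h _ hp hpa => padic_bound_a₂ hK hP h 0 hp hpa)
    (fun h h1 _ hp hpc => padic_bound_c₂ hK hP h h1 0 hp hpc)

/-! ### The full library rung -/

/-- **A1.L ⇒ Stewart–Tijdeman 1986.** [cite: StewartTijdeman1986, Theorem 1 (upper bound), as quoted in Waldschmidt2014 §2 (PDF p. 3)]
[cite: Pasten2024, Theorem 2.1 (d = 1)] -/
theorem stewartTijdeman1986_of_approximationBound_rat (h : approximationBound_rat) :
    stewartTijdeman1986_upperBound :=
  stewartTijdeman1986_of_padicApproximationBound_rat (padicApproximationBound_rat_of h)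

/-- **A1.L ⇒ Stewart–Yu 1991.** [cite: StewartYu1991, main theorem] [cite: Pasten2024, Theorem 2.1 (d = 1)] -/
theorem stewartYu1991_of_approximationBound_rat (h : approximationBound_rat) :
    stewartYu1991_upperBound :=
  stewartYu1991_of_padicApproximationBound_rat (padicApproximationBound_rat_of h)

/-- **A1.L ⇒ `BakerMethodBounds`** (Stewart–Yu 2001 Theorem 1; here with BOTH clauses of the rung,
through `BakerMethodBounds_of_approximationBound` — the archimedean clause replaces Waldschmidt's
proposition; compare `BakerMethodBounds_of_padicApproximationBound_rat`).
[cite: StewartYu2001, Theorem 1] [cite: Pasten2024, Theorem 2.1 (d = 1)] -/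
theorem BakerMethodBounds_of_approximationBound_rat (h : approximationBound_rat) :
    BakerMethodBounds := by
  obtain ⟨K, hK, hP⟩ := h
  exact BakerMethodBounds_of_approximationBound hK hP

/-- **A1.L ⇒ Stewart–Yu 2001 Theorem 1** (`stewart_yu`). [cite: StewartYu2001, Theorem 1]
[cite: Pasten2024, Theorem 2.1 (d = 1)] -/
theorem stewart_yu_of_approximationBound_rat (h : approximationBound_rat) :
    Literature.NumberTheory.DiophantineGeometry.stewart_yu :=
  BakerMethodBounds_iff_stewartYu.mp (BakerMethodBounds_of_approximationBound_rat h)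

/-- **A1.L ⇒ Stewart–Yu 2001 Theorem 2** (through `StewartYu2001.stewartYu2001_thm2_of_approximationBound`:
all three place bounds from the rung). [cite: StewartYu2001, Theorem 2] [cite: Pasten2024, Theorem 2.1 (d = 1)] -/
theorem stewartYu2001_thm2_of_approximationBound_rat (h : approximationBound_rat) :
    stewartYu2001_thm2 := by
  obtain ⟨K, hK, hP⟩ := h
  exact stewartYu2001_thm2_of_approximationBound hK hP

/-! ### Theorem 2 from Yu 2007 alone, Literature-side -/

/-- **Stewart–Yu 2001 Theorem 2 from the single primary fact `yu2007_padicLogForm_rat`** (Yu 2007 =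
Evertse–Győry Thm 3.2.7 over `ℚ`): `Dioph.padicApproximationBound_rat_of_yu2007` gives the `p`-adic
half of the library rung, and `stewartYu2001_thm2_of_padicApproximationBound_rat` the theorem (the
archimedean input being the tree's theorem `waldschmidt1980_hW₂`).  Inside `Literature/` this lowers
the trust base of `stewartYu2001_thm2` from `{matveev2000_linearFormsLog_rat, yu2007_padicLogForm_rat}`
(`StewartYu2001.stewartYu2001_thm2_of_matveev_yu`) to `{yu2007_padicLogForm_rat}`; the summit cone
reaches the same base by the primes-only road (`Summit.ABC.StewartYu.ThmTwo.stewartYu2001_thm2_of_yu2007`).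
[cite: StewartYu2001, Theorem 2] [cite: EvertseGyory2015, Thm 3.2.7 (p. 62)]
[cite: Waldschmidt1980, Prop 3.8 (p. 274)] -/
theorem stewartYu2001_thm2_of_yu2007_rat (h : yu2007_padicLogForm_rat) : stewartYu2001_thm2 :=
  stewartYu2001_thm2_of_padicApproximationBound_rat (padicApproximationBound_rat_of_yu2007 h)

end Literature.Barriers.ABC

end
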